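import Literature.NumberTheory.Automorphic.UnitaryGroupLineConjFundamentalDomainTwo
import Literature.NumberTheory.Automorphic.UnitaryGroupSiegelFiniteShadowTwo
import Literature.NumberTheory.Automorphic.FiniteAdeleCompactValuationDepth
import HarnessLib

/-!
# The level depth on the Siegel set of `U(J₂)`: a rational dilation `β = diag(m⁻¹, m)` making
# `|d₀⁻¹d₁(β)|_v · |d₀⁻¹d₁(b)|_v · |½|_v ≤ |𝔫|_v, |c⁻¹ • 𝔫|_v` for every `b` in the Siegel set
(Rogawski, *Automorphic Representations of Unitary Groups in Three Variables* (1990), §2.2 (p. 13); Cassels–Fröhlich,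
*Algebraic Number Theory* (1967), Ch. II §16)

Topic `NumberTheory/Automorphic`; namespace `Literature.NumberTheory.Automorphic.UnitaryGroup`. THEOREMS ONLY
(kernel lane: no definition, no named fact, no instance, no notation, no `sorry`). H-side LAW 1 at `N = 2`, row
(R6b-ii) «m-DEPTH» of B-p14 (g26)'s list = the `N = 2` sibling of ★ `UnitaryGroupSiegelConjLevelDepth`
(`exists_rational_borel_forall_valuation_conj_le`): the two valuation inequalities per finite place which ★
`UnitaryGroupLineConjFundamentalDomainTwo.exists_isCompact_forall_oneFactor_dilated_two` (R6b-i) asks of the level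
`𝔫`, the dilation `β` and the Borel element `b`, DISCHARGED uniformly on the Siegel set `S = Ω · S_T · (B(𝔸_F) ∩ K)`
by an ARITHMETIC CHOICE of `β`.

THE POINT. At `N = 2` the line `N(𝔸_F) ≅ 𝔸_E⁻` carries ONE root value `d₀⁻¹d₁ = (d₀ · c(d₀))⁻¹`; for the rational
diagonal `β = diag(m⁻¹, m)` (`d₀(β) = ι(m⁻¹)`, ★ `exists_rational_torus_two`) it is the principal adèle `m²`, so
`|d₀⁻¹d₁(β)|_v = |m|_v²`. The finite shadow of `d₀⁻¹d₁(b)` on the Siegel set lies in a compact of `𝔸_E^∞` (★ (R5)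
`exists_isCompact_snd_rootValue_mem_two`, from the EXPORT `d₀(t) = w · posRealIdele E (e^s)` alone), hence (letter
`hA1`, ★ `exists_finset_nat_forall_valued_le_of_isCompact`) `|d₀⁻¹d₁(b)|_v, |½|_v ≤ 1` off a finite `T` and `≤ exp n`
everywhere; the letter `hA2` (★ `exists_natCast_valued_mul_exp_le`) picks `m ∈ ℕ` with `|m|_v ≤ 1` everywhere and
`|m|_v · exp(2n) ≤ min(|𝔫|_v, |c⁻¹ • 𝔫|_v)` on `T ∪ supp 𝔫 ∪ supp c⁻¹ • 𝔫`; off that set every factor is `≤ 1 = |𝔫|_v`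
(★ `idealRadius_eq_one_of_not_dvd`).

* `coe_rootValue_eq_algebraMap_sq_two` — the root value of the rational diagonal with `d₀ = ι(m⁻¹)` is `ι(m²)`.
* `exists_rational_borel_forall_valuation_le_two_of_letters` (the two letters as hypotheses) and
  **`exists_rational_borel_forall_valuation_le_two`** (letters discharged): `∃ β` rational, `torusPart β = β`, with
  the two inequalities for all `b ∈ S` and all `v` — no height guard.
* **`exists_rational_borel_forall_valuation_conj_le_two`** = the `hdepth` hypothesis of B-p08 (g21)'s `U(J₂)` Siegel
  closer ★ `truncatedKernelClassIntegrable_of_levelDepth_two` VERBATIM (entries of `π(b⁻¹ u b)` and their conjugates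
  `𝔫`-divisible for `u ∈ β⁻¹ n(𝓕⁻) β`; ★ `hval_of_mem_borelConj_image_two` of (R6b-i) fed by the two inequalities).

## References
* J. D. Rogawski, *Automorphic Representations of Unitary Groups in Three Variables*, Ann. of Math. Stud. 123
  (1990), §1.10, §2.2 (p. 13) [Rogawski1990].
* J. W. S. Cassels, A. Fröhlich (eds.), *Algebraic Number Theory* (1967), Ch. II §16, Ch. VII §1.1
  [CasselsFrohlichANT1967].
* J. R. Getz, H. Hahn, *An Introduction to Automorphic Representations*, GTM 300 (2024), §2.7 [GetzHahn2024].
-/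

set_option autoImplicit false

noncomputable section

open Matrix NumberField IsDedekindDomain Topology Set
open scoped MatrixGroups Pointwise

namespace Literature.NumberTheory.Automorphic

namespace UnitaryGroup

variable {F E : Type} [Field F] [NumberField F] [Field E] [NumberField E] [Algebra F E]
  {c : E ≃ₐ[F] E}

/-! ## §1 Letters -/

omit [NumberField F] [Algebra F E] in
/-- The component of a product of adèles at a finite place (definitional). [folklore] -/
private theorem snd_mul_apply₂ (x y : AdeleRing (𝓞 E) E) (v : HeightOneSpectrum (𝓞 E)) : (x * y).2 v = x.2 v * y.2 v := rfl

omit [NumberField F] [Algebra F E] in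
/-- The principal adèle of a natural number has component `m` at every finite place. [folklore] -/
private theorem valued_snd_algebraMap_natCast₂ (m : ℕ) (v : HeightOneSpectrum (𝓞 E)) :
    Valued.v ((algebraMap E (AdeleRing (𝓞 E) E) (m : E)).2 v) = Valued.v ((m : v.adicCompletion E)) := by
  rw [map_natCast]
  rfl

omit [NumberField F] [Algebra F E] in
/-- `|𝔫|_v ≠ 0` (it is an `exp`). [folklore] -/
private theorem idealRadius_ne_zero₂ (v : HeightOneSpectrum (𝓞 E)) (𝔫 : Ideal (𝓞 E)) : idealRadius E v 𝔫 ≠ 0 := by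
  unfold idealRadius
  exact WithZero.exp_ne_zero

/-- **The root value of the rational diagonal `β = diag(m⁻¹, m)` is the principal adèle `m²`**: if `torusPart β = β` and
`d₀(β) = ι(m⁻¹)` (★ `exists_rational_torus_two` at `k = m⁻¹`), then `d₀⁻¹d₁(β) = d₀⁻¹ (c • d₀)⁻¹ = ι(m) ι(c m) = ι(m²)`
(`m ∈ ℕ` is `c`-fixed). [cite: Rogawski1990, §1.10] -/
theorem coe_rootValue_eq_algebraMap_sq_two {β : borelAdelic F E c 2} (hβt : torusPart β = β) {m : ℕ} (hmE : (m : E) ≠ 0)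
    (hβ0 : diagUnit β.2 0 = principalIdele E (Units.mk0 (m : E) hmE)⁻¹) :
    ((((diagUnit β.2 0)⁻¹ * diagUnit β.2 1 : (AdeleRing (𝓞 E) E)ˣ)) : AdeleRing (𝓞 E) E) =
      algebraMap E (AdeleRing (𝓞 E) E) ((m : E) * (m : E)) := by
  have hk : (((Units.mk0 (m : E) hmE)⁻¹ : Eˣ) : E) = (m : E)⁻¹ := by
    rw [Units.val_inv_eq_inv_val, Units.val_mk0]
  have hcoe : ((principalIdele E (Units.mk0 (m : E) hmE)⁻¹ : (AdeleRing (𝓞 E) E)ˣ) : AdeleRing (𝓞 E) E) =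
      algebraMap E (AdeleRing (𝓞 E) E) ((m : E)⁻¹) := by
    rw [← hk]; rfl
  have hinv0 : (((diagUnit β.2 0)⁻¹ : (AdeleRing (𝓞 E) E)ˣ) : AdeleRing (𝓞 E) E) = algebraMap E (AdeleRing (𝓞 E) E) (m : E) := by
    refine Units.inv_eq_of_mul_eq_one_left ?_
    rw [hβ0, hcoe, ← map_mul, mul_inv_cancel₀ hmE, map_one]
  have hinv1 : (((c • diagUnit β.2 0)⁻¹ : (AdeleRing (𝓞 E) E)ˣ) : AdeleRing (𝓞 E) E) = algebraMap E (AdeleRing (𝓞 E) E) (m : E) := by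
    refine Units.inv_eq_of_mul_eq_one_left ?_
    rw [val_smul_eq_conjAdele, hβ0, hcoe, ← algebraMap_conj, RingHom.coe_coe, map_inv₀, map_natCast c, ← map_mul,
      mul_inv_cancel₀ hmE, map_one]
  rw [coe_rootValue_two hβt, Units.val_mul, hinv0, hinv1, ← map_mul]

/-! ## §2 The level depth on the Siegel set -/

/-- **THE LEVEL DEPTH ON THE SIEGEL SET OF `U(J₂)`, from the two generic valuation letters.** See
`exists_rational_borel_forall_valuation_le_two` for the statement; here «valuations are bounded on a compact of `𝔸_E^∞`
and `≤ 1` off a finite set» (`hA1`) and «a natural number `m` with `|m|_v ≤ 1` everywhere and `|m|_v` as small as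
prescribed on a finite set» (`hA2`) are hypotheses. [cite: Rogawski1990, §2.2 (p. 13)] [cite: CasselsFrohlichANT1967, Ch. II §16] -/
theorem exists_rational_borel_forall_valuation_le_two_of_letters
    (hA1 : ∀ {C : Set (FiniteAdeleRing (𝓞 E) E)}, IsCompact C →
      ∃ T : Finset (HeightOneSpectrum (𝓞 E)), ∃ n : ℕ,
        (∀ x ∈ C, ∀ v : HeightOneSpectrum (𝓞 E), v ∉ T → Valued.v (x v) ≤ 1) ∧
        (∀ x ∈ C, ∀ v : HeightOneSpectrum (𝓞 E), Valued.v (x v) ≤ WithZero.exp (n : ℤ)))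
    (hA2 : ∀ (T : Finset (HeightOneSpectrum (𝓞 E))) (n : ℕ)
      (r : HeightOneSpectrum (𝓞 E) → WithZero (Multiplicative ℤ)), (∀ v ∈ T, r v ≠ 0) →
      ∃ m : ℕ, m ≠ 0 ∧ (∀ v : HeightOneSpectrum (𝓞 E), Valued.v ((m : v.adicCompletion E)) ≤ 1) ∧
        ∀ v ∈ T, Valued.v ((m : v.adicCompletion E)) * WithZero.exp (n : ℤ) ≤ r v)
    (hc : c * c = 1) {Ω ST : Set (borelAdelic F E c 2)} (hΩ : IsCompact Ω) {W : Set (AdeleRing (𝓞 E) E)ˣ}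
    (hW : IsCompact W) (hSTt : ∀ t ∈ ST, torusPart t = t)
    (hexp : ∀ t ∈ ST, ∃ w ∈ W, ∃ s : ℝ, diagUnit t.2 0 = w * posRealIdele E (expUnitNNReal s))
    {𝔫 : Ideal (𝓞 E)} (h𝔫 : 𝔫 ≠ 0) :
    ∃ β : borelAdelic F E c 2, (β : (quasiSplit F E c 2).Adelic) ∈ (quasiSplit F E c 2).arithmeticSubgroup ∧
      torusPart β = β ∧
      ∀ b ∈ Ω * ST * {k : borelAdelic F E c 2 |
          adelicVal F E c 2 ((StdForm.antidiagonal 2).over E) (k : (quasiSplit F E c 2).Adelic) ∈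
            standardMaximalCompactGL 2 E},
        ∀ v : HeightOneSpectrum (𝓞 E),
          Valued.v ((((((diagUnit β.2 0)⁻¹ * diagUnit β.2 1 : (AdeleRing (𝓞 E) E)ˣ)) : AdeleRing (𝓞 E) E)).2 v) *
            Valued.v ((((((diagUnit b.2 0)⁻¹ * diagUnit b.2 1 : (AdeleRing (𝓞 E) E)ˣ)) : AdeleRing (𝓞 E) E)).2 v) *
              Valued.v ((halfAdele : AdeleRing (𝓞 E) E).2 v) ≤ idealRadius E v 𝔫 ∧
          Valued.v ((((((diagUnit β.2 0)⁻¹ * diagUnit β.2 1 : (AdeleRing (𝓞 E) E)ˣ)) : AdeleRing (𝓞 E) E)).2 v) *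
            Valued.v ((((((diagUnit b.2 0)⁻¹ * diagUnit b.2 1 : (AdeleRing (𝓞 E) E)ˣ)) : AdeleRing (𝓞 E) E)).2 v) *
              Valued.v ((halfAdele : AdeleRing (𝓞 E) E).2 v) ≤ idealRadius E v (c⁻¹ • 𝔫) := by
  classical
  -- (R5): the finite shadow of the root value on the Siegel set is compact
  obtain ⟨Cα, hCαc, hαmem⟩ := exists_isCompact_snd_rootValue_mem_two (ST := ST) hΩ hW hSTt hexp
  -- `hA1` on `Cα ∪ {½}`
  obtain ⟨T, n, hT1, hTn⟩ := hA1 (hCαc.union (isCompact_singleton (x := (halfAdele : AdeleRing (𝓞 E) E).2)))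
  -- the bad set of places and the prescribed radii
  have h𝔫' : c⁻¹ • 𝔫 ≠ 0 := fun h => h𝔫 ((Ideal.smul_eq_bot_iff c⁻¹ 𝔫).1 h)
  set T' : Finset (HeightOneSpectrum (𝓞 E)) := T ∪ (Ideal.finite_factors h𝔫).toFinset ∪
    (Ideal.finite_factors h𝔫').toFinset with hT'
  set r : HeightOneSpectrum (𝓞 E) → WithZero (Multiplicative ℤ) := fun v =>
    min (idealRadius E v 𝔫) (idealRadius E v (c⁻¹ • 𝔫)) with hr
  have hr0 : ∀ v ∈ T', r v ≠ 0 := fun v _ => by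
    rcases min_choice (idealRadius E v 𝔫) (idealRadius E v (c⁻¹ • 𝔫)) with h | h
    · rw [hr]; simp only; rw [h]; exact idealRadius_ne_zero₂ v 𝔫
    · rw [hr]; simp only; rw [h]; exact idealRadius_ne_zero₂ v _
  obtain ⟨m, hm0, hm1, hmT⟩ := hA2 T' (2 * n) r hr0
  -- the rational diagonal `β = diag(m⁻¹, m)`
  have hmE : (m : E) ≠ 0 := Nat.cast_ne_zero.2 hm0
  have hcc : ∀ x : E, c (c x) = x := fun x => by rw [← AlgEquiv.mul_apply, hc, AlgEquiv.one_apply]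
  obtain ⟨β, hrat, hβt, hβ0⟩ := exists_rational_torus_two (F := F) (E := E) (c := c) hcc (Units.mk0 (m : E) hmE)⁻¹
  have hMv : ∀ v : HeightOneSpectrum (𝓞 E),
      Valued.v ((((((diagUnit β.2 0)⁻¹ * diagUnit β.2 1 : (AdeleRing (𝓞 E) E)ˣ)) : AdeleRing (𝓞 E) E)).2 v) =
        Valued.v ((m : v.adicCompletion E)) * Valued.v ((m : v.adicCompletion E)) := fun v => by
    rw [coe_rootValue_eq_algebraMap_sq_two hβt hmE hβ0, map_mul, snd_mul_apply₂, map_mul, valued_snd_algebraMap_natCast₂]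
  refine ⟨β, hrat, hβt, fun b hb v => ?_⟩
  -- the per-place bounds on `α = d₀⁻¹d₁(b)` and `½`
  have hαC : (((((diagUnit b.2 0)⁻¹ * diagUnit b.2 1 : (AdeleRing (𝓞 E) E)ˣ)) : AdeleRing (𝓞 E) E)).2 ∈
      Cα ∪ {(halfAdele : AdeleRing (𝓞 E) E).2} := Or.inl (hαmem b hb)
  have hhC : (halfAdele : AdeleRing (𝓞 E) E).2 ∈ Cα ∪ {(halfAdele : AdeleRing (𝓞 E) E).2} := Or.inr rfl
  set vα := Valued.v ((((((diagUnit b.2 0)⁻¹ * diagUnit b.2 1 : (AdeleRing (𝓞 E) E)ˣ)) : AdeleRing (𝓞 E) E)).2 v) with hvα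
  set vh := Valued.v ((halfAdele : AdeleRing (𝓞 E) E).2 v) with hvh
  set vm := Valued.v ((m : v.adicCompletion E)) with hvm
  have hαn : vα ≤ WithZero.exp (n : ℤ) := hTn _ hαC v
  have hhn : vh ≤ WithZero.exp (n : ℤ) := hTn _ hhC v
  -- `|m| |α| |½| ≤ exp (2n)`
  have hX : vm * vα * vh ≤ WithZero.exp ((2 * n : ℕ) : ℤ) :=
    calc vm * vα * vh ≤ 1 * WithZero.exp (n : ℤ) * WithZero.exp (n : ℤ) := mul_le_mul' (mul_le_mul' (hm1 v) hαn) hhn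
      _ = WithZero.exp ((2 * n : ℕ) : ℤ) := by rw [one_mul, ← WithZero.exp_add]; congr 1; push_cast; ring
  rw [hMv]
  have e : vm * vm * vα * vh = vm * (vm * vα * vh) := by simp only [mul_assoc]
  rw [e]
  by_cases hv : v ∈ T'
  · have h2 : vm * (vm * vα * vh) ≤ r v := (mul_le_mul' le_rfl hX).trans (hmT v hv)
    exact ⟨h2.trans (min_le_left _ _), h2.trans (min_le_right _ _)⟩
  · have hvT : v ∉ T := fun h => hv (by rw [hT']; simp [h])
    have hv𝔫 : ¬ v.asIdeal ∣ 𝔫 := fun h => hv (by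
      rw [hT']; simp only [Finset.mem_union, Set.Finite.mem_toFinset, Set.mem_setOf_eq]; exact Or.inl (Or.inr h))
    have hv𝔫' : ¬ v.asIdeal ∣ c⁻¹ • 𝔫 := fun h => hv (by
      rw [hT']; simp only [Finset.mem_union, Set.Finite.mem_toFinset, Set.mem_setOf_eq]; exact Or.inr h)
    rw [idealRadius_eq_one_of_not_dvd h𝔫 hv𝔫, idealRadius_eq_one_of_not_dvd h𝔫' hv𝔫']
    have h1 : vm * (vm * vα * vh) ≤ 1 :=
      mul_le_one' (hm1 v) (mul_le_one' (mul_le_one' (hm1 v) (hT1 _ hαC v hvT)) (hT1 _ hhC v hvT))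
    exact ⟨h1, h1⟩

/-- **THE LEVEL DEPTH ON THE SIEGEL SET OF `U(J₂)` — the two inequalities of ★ `exists_isCompact_forall_oneFactor_dilated_two`
(R6b-i), DISCHARGED uniformly on the Siegel set.**  For `Ω ⊆ B(𝔸_F)` compact, a torus set `S_T` (`torusPart t = t`) with
the EXPORT `d₀(t) = w · posRealIdele E (e^s)` (`w ∈ W`, `W ⊆ 𝕀_E` compact — ★ `exists_torusSiegelSet_two`) and every
level `𝔫 ≠ 0`, there is a RATIONAL torus element `β` (the diagonal `diag(m⁻¹, m)`, `m ∈ ℕ`, of ★ `exists_rational_torus_two`;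
root value `ι(m²)`, `coe_rootValue_eq_algebraMap_sq_two`) with `|d₀⁻¹d₁(β)|_v · |d₀⁻¹d₁(b)|_v · |½|_v ≤ |𝔫|_v` and
`≤ |c⁻¹ • 𝔫|_v` for every `b ∈ Ω · S_T · (B(𝔸_F) ∩ K)` and every finite place `v`.  PROOF = `…_of_letters` fed by ★
`exists_finset_nat_forall_valued_le_of_isCompact` and ★ `exists_natCast_valued_mul_exp_le` (A-p09). Consequently (★
`isFundamentalDomain_borelConj_image_two`, ★ `exists_isCompact_forall_oneFactor_dilated_two`) the dilated line domain
`𝓕₀ = β⁻¹ n(𝓕⁻) β` serves the level-`𝔫` geometry clause of the `N = 2` row package.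
[cite: Rogawski1990, §2.2 (p. 13)] [cite: CasselsFrohlichANT1967, Ch. II §16] -/
theorem exists_rational_borel_forall_valuation_le_two (hc : c * c = 1)
    {Ω ST : Set (borelAdelic F E c 2)} (hΩ : IsCompact Ω) {W : Set (AdeleRing (𝓞 E) E)ˣ}
    (hW : IsCompact W) (hSTt : ∀ t ∈ ST, torusPart t = t)
    (hexp : ∀ t ∈ ST, ∃ w ∈ W, ∃ s : ℝ, diagUnit t.2 0 = w * posRealIdele E (expUnitNNReal s))
    {𝔫 : Ideal (𝓞 E)} (h𝔫 : 𝔫 ≠ 0) :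
    ∃ β : borelAdelic F E c 2, (β : (quasiSplit F E c 2).Adelic) ∈ (quasiSplit F E c 2).arithmeticSubgroup ∧
      torusPart β = β ∧
      ∀ b ∈ Ω * ST * {k : borelAdelic F E c 2 |
          adelicVal F E c 2 ((StdForm.antidiagonal 2).over E) (k : (quasiSplit F E c 2).Adelic) ∈
            standardMaximalCompactGL 2 E},
        ∀ v : HeightOneSpectrum (𝓞 E),
          Valued.v ((((((diagUnit β.2 0)⁻¹ * diagUnit β.2 1 : (AdeleRing (𝓞 E) E)ˣ)) : AdeleRing (𝓞 E) E)).2 v) *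
            Valued.v ((((((diagUnit b.2 0)⁻¹ * diagUnit b.2 1 : (AdeleRing (𝓞 E) E)ˣ)) : AdeleRing (𝓞 E) E)).2 v) *
              Valued.v ((halfAdele : AdeleRing (𝓞 E) E).2 v) ≤ idealRadius E v 𝔫 ∧
          Valued.v ((((((diagUnit β.2 0)⁻¹ * diagUnit β.2 1 : (AdeleRing (𝓞 E) E)ˣ)) : AdeleRing (𝓞 E) E)).2 v) *
            Valued.v ((((((diagUnit b.2 0)⁻¹ * diagUnit b.2 1 : (AdeleRing (𝓞 E) E)ˣ)) : AdeleRing (𝓞 E) E)).2 v) *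
              Valued.v ((halfAdele : AdeleRing (𝓞 E) E).2 v) ≤ idealRadius E v (c⁻¹ • 𝔫) :=
  exists_rational_borel_forall_valuation_le_two_of_letters
    (fun hC => exists_finset_nat_forall_valued_le_of_isCompact (K := E) hC)
    (fun T n r hr => exists_natCast_valued_mul_exp_le (K := E) T n r hr) hc hΩ hW hSTt hexp h𝔫

/-! ## §3 The `hdepth` hypothesis of the `U(J₂)` Siegel closer, discharged -/

/-- **THE LEVEL DEPTH ON THE SIEGEL SET OF `U(J₂)` — the `hdepth` hypothesis of ★ `truncatedKernelClassIntegrable_of_levelDepth_two`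
(B-p08 (g21), `UnitaryGroupTruncatedKernelClassIntegrableOfSiegelTwo`), DISCHARGED, binders verbatim.**  For `Ω ⊆ B(𝔸_F)` compact, a
torus set `S_T` with the EXPORT `d₀(t) = w · posRealIdele E (e^s)` (`w ∈ W` compact) and every level `𝔫 ≠ 0` there is a RATIONAL
Borel element `β` (the diagonal `diag(m⁻¹, m)` of `exists_rational_borel_forall_valuation_le_two`) such that for every `b` in the
Siegel set `Ω · S_T · (B(𝔸_F) ∩ K)` and every `u` in the dilated line domain `β⁻¹ n(𝓕⁻) β` the off-diagonal entries of `π(b⁻¹ u b)`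
and their `c`-conjugates are `𝔫`-divisible at every finite place (★ `hval_of_mem_borelConj_image_two`). The height guard
`1 ≤ H(b)` is not used. [cite: Rogawski1990, §2.2 (p. 13)] [cite: CasselsFrohlichANT1967, Ch. II §16] -/
theorem exists_rational_borel_forall_valuation_conj_le_two (hc : c * c = 1)
    {Ω ST : Set (borelAdelic F E c 2)} (hΩ : IsCompact Ω) {W : Set (AdeleRing (𝓞 E) E)ˣ}
    (hW : IsCompact W) (hSTt : ∀ t ∈ ST, torusPart t = t)
    (hexp : ∀ t ∈ ST, ∃ w ∈ W, ∃ s : ℝ, diagUnit t.2 0 = w * posRealIdele E (expUnitNNReal s))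
    {𝔫 : Ideal (𝓞 E)} (h𝔫 : 𝔫 ≠ 0) :
    ∃ β : borelAdelic F E c 2, (β : (quasiSplit F E c 2).Adelic) ∈ (quasiSplit F E c 2).arithmeticSubgroup ∧
      ∀ b ∈ Ω * ST * {k : borelAdelic F E c 2 |
          adelicVal F E c 2 ((StdForm.antidiagonal 2).over E) (k : (quasiSplit F E c 2).Adelic) ∈
            standardMaximalCompactGL 2 E},
      1 ≤ borelHeight (b : (quasiSplit F E c 2).Adelic) →
      ∀ u ∈ (fun v : adelicUnipotent F E c 2 =>
          (⟨(β : (quasiSplit F E c 2).Adelic)⁻¹ * (v : (quasiSplit F E c 2).Adelic) * (β : (quasiSplit F E c 2).Adelic),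
            conj_mem_adelicUnipotent β.2 v.2⟩ : adelicUnipotent F E c 2)) ''
          ((fun y : traceZeroAdele F E c =>
            middleRootUnipotent (F := F) (E := E) (c := c) (N := 2) (i := 0) (j := 1) rfl rfl
              (Multiplicative.ofAdd y)) '' traceZeroFundamentalDomain F E c),
        ∀ i j : Fin 2, i ≠ j → ∀ v : HeightOneSpectrum (𝓞 E),
          Valued.v ((((adelicVal F E c 2 _ ((b : (quasiSplit F E c 2).Adelic)⁻¹ *
              (u : (quasiSplit F E c 2).Adelic) * (b : (quasiSplit F E c 2).Adelic)) :
            GL (Fin 2) (AdeleRing (𝓞 E) E)) : Matrix (Fin 2) (Fin 2) (AdeleRing (𝓞 E) E)) i j).2 v) ≤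
              idealRadius E v 𝔫 ∧
          Valued.v ((conjAdele F E c (((adelicVal F E c 2 _ ((b : (quasiSplit F E c 2).Adelic)⁻¹ *
              (u : (quasiSplit F E c 2).Adelic) * (b : (quasiSplit F E c 2).Adelic)) :
            GL (Fin 2) (AdeleRing (𝓞 E) E)) : Matrix (Fin 2) (Fin 2) (AdeleRing (𝓞 E) E)) i j)).2 v) ≤
              idealRadius E v 𝔫 := by
  obtain ⟨β, hrat, -, hineq⟩ := exists_rational_borel_forall_valuation_le_two hc hΩ hW hSTt hexp h𝔫
  exact ⟨β, hrat, fun b hb _ u hu => hval_of_mem_borelConj_image_two rfl rfl hc β b 𝔫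
    (fun v => (hineq b hb v).1) (fun v => (hineq b hb v).2) hu⟩

end UnitaryGroup

end Literature.NumberTheory.Automorphic

end
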